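import Literature.Computability.Complexity.DrivenSignMachineStream
import HarnessLib

/-!
# The oracle-driven sign machine, III: blocks of driver rounds — prefix search and transmission

Topic `Literature/Computability/Complexity`, grouping namespace `FKTransfer`, sequel of
`DrivenSignMachineStream.lean` (`driveBits δ hist k`: the `k` bits a driver `δ` produces in `k`
consecutive driver rounds after the history `hist`; `stream_frame`: a frame of the driven sign
machine is `P - 1` driver rounds followed by a sign round on the last `m` bits). The driver rounds
of a frame are used in two ways in Fournier–Koiran's procedure (ICALP 2000 = LIP RR-1999-21,
§2.1: "Since the condition `H_n^1 ≠ ∅` is in NP, we can compute `E_1` by prefix search with an NP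
oracle … Such an `h` can be determined by prefix search"), and this file proves, machine-free, what
each use achieves:

* `driveBits_add` — consecutive blocks compose;
* **prefix search** (`driveBits_prefixSearch`): if in a block of `s` rounds the driver answers, after
  the partial block `p`, the question "is there a witness `w` of length `s` with `R w` extending
  `p1`?" (an `NP` question when `R` is), and some witness exists, then the block produced IS a
  witness: `R (driveBits δ hist s)` (the invariant `PrefixExtendable`: the partial block extends to
  a witness);
* **transmission** (`driveBits_transmit`): if the driver answers bit `|p|` of a fixed string `c`,
  the block produced is `c` (so a sign round placed after it probes exactly the form coded by `c`,
  `stream_frame`).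

## References

* H. Fournier, P. Koiran, *Lower bounds are not easier over the reals: inside PH*, ICALP 2000,
  LNCS 1853 = LIP RR-1999-21, §2.1 (prefix search with an `NP` oracle). [FournierKoiran2000]
  (The invariant below is the elementary one behind witness search with an `NP` oracle; nothing
  beyond the report's use of it is formalised.)
-/

namespace Literature.Computability.Complexity

namespace FKTransfer

variable {δ : List Bool → Bool}

/-! ### Blocks compose -/

/-- **Consecutive blocks of driver rounds compose**:
`driveBits δ hist (a + b) = driveBits δ hist a ++ driveBits δ (hist ++ driveBits δ hist a) b`. [folklore] -/
theorem driveBits_add (δ : List Bool → Bool) (hist : List Bool) (a : ℕ) :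
    ∀ b, driveBits δ hist (a + b) = driveBits δ hist a ++ driveBits δ (hist ++ driveBits δ hist a) b
  | 0 => by simp [driveBits]
  | b + 1 => by
    rw [← Nat.add_assoc, driveBits, driveBits_add δ hist a b, driveBits, List.append_assoc, List.append_assoc]

/-- The block of `k + 1` rounds extends the block of `k` rounds by the driver's next bit. [folklore] -/
theorem driveBits_succ (δ : List Bool → Bool) (hist : List Bool) (k : ℕ) :
    driveBits δ hist (k + 1) = driveBits δ hist k ++ [δ (hist ++ driveBits δ hist k)] :=
  rfl

/-- Earlier partial blocks are prefixes of later ones. [folklore] -/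
theorem driveBits_prefix (δ : List Bool → Bool) (hist : List Bool) {j k : ℕ} (h : j ≤ k) :
    driveBits δ hist j <+: driveBits δ hist k := by
  obtain ⟨b, rfl⟩ := Nat.exists_eq_add_of_le h
  rw [driveBits_add]
  exact List.prefix_append _ _

/-! ### Prefix search -/

/-- The invariant of prefix search: the partial block `p` extends to a witness of length `s`.
[cite: FournierKoiran2000, §2.1 (prefix search)] -/
def PrefixExtendable (R : List Bool → Prop) (s : ℕ) (p : List Bool) : Prop :=
  ∃ w : List Bool, w.length = s ∧ p <+: w ∧ R w

/-- A prefix-search driver on the block: after the partial block `p` (`|p| < s`) it answers whether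
`p1` extends to a witness. [cite: FournierKoiran2000, §2.1] -/
def IsPrefixSearchDriver (δ : List Bool → Bool) (hist : List Bool) (R : List Bool → Prop) (s : ℕ) : Prop :=
  ∀ p : List Bool, p.length < s → (δ (hist ++ p) = true ↔ PrefixExtendable R s (p ++ [true]))

/-- **One step of prefix search keeps the invariant**: if `p` (`|p| < s`) extends to a witness then so
does `p b` for the answer bit `b = [p1 extends to a witness]`. [cite: FournierKoiran2000, §2.1] -/
theorem PrefixExtendable.step {R : List Bool → Prop} {s : ℕ} {p : List Bool} (hp : p.length < s)
    (hext : PrefixExtendable R s p) (b : Bool) (hb : b = true ↔ PrefixExtendable R s (p ++ [true])) :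
    PrefixExtendable R s (p ++ [b]) := by
  cases b with
  | true => exact hb.1 rfl
  | false =>
    obtain ⟨w, hw, hpw, hR⟩ := hext
    refine ⟨w, hw, ?_, hR⟩
    -- `w` is longer than `p`, and its next bit cannot be `1`
    obtain ⟨t, rfl⟩ := hpw
    cases t with
    | nil => simp at hw; omega
    | cons c t =>
      cases c with
      | false => exact ⟨t, by simp⟩
      | true =>
        exact absurd (hb.2 ⟨p ++ true :: t, hw, ⟨t, by simp⟩, hR⟩) (by simp)

/-- **Prefix search with an oracle finds a witness.** If the driver answers the prefix-search
questions of `R` on a block of `s` rounds and some witness of length `s` exists, the block it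
produces is a witness. [cite: FournierKoiran2000, §2.1 ("Such an `h` can be determined by prefix search")] -/
theorem driveBits_prefixSearch {hist : List Bool} {R : List Bool → Prop} {s : ℕ}
    (hδ : IsPrefixSearchDriver δ hist R s) (hex : ∃ w : List Bool, w.length = s ∧ R w) :
    R (driveBits δ hist s) := by
  have inv : ∀ j ≤ s, PrefixExtendable R s (driveBits δ hist j) := by
    intro j
    induction j with
    | zero =>
      intro _
      obtain ⟨w, hw, hR⟩ := hex
      exact ⟨w, hw, List.nil_prefix, hR⟩
    | succ j ih =>
      intro hj
      rw [driveBits_succ]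
      have hlen : (driveBits δ hist j).length < s := by rw [length_driveBits]; omega
      exact (ih (Nat.le_of_succ_le hj)).step hlen _ (hδ _ hlen)
  obtain ⟨w, hw, hpw, hR⟩ := inv s le_rfl
  have : driveBits δ hist s = w := hpw.eq_of_length (by rw [length_driveBits, hw])
  rwa [this]

/-- The witness found has length `s` (restated for convenience). [folklore] -/
theorem length_driveBits_prefixSearch (hist : List Bool) (s : ℕ) : (driveBits δ hist s).length = s :=
  length_driveBits hist s

/-! ### Transmission -/

/-- A transmitting driver on the block: after the partial block `p` it answers bit `|p|` of `c`.
[cite: FournierKoiran2000, §2 (p. 4: the oracle query is written bit by bit)] -/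
def IsTransmitDriver (δ : List Bool → Bool) (hist c : List Bool) : Prop :=
  ∀ p : List Bool, p.length < c.length → δ (hist ++ p) = c.getD p.length false

/-- **A transmitting driver spells out `c`.** [cite: FournierKoiran2000, §2 (p. 4)] -/
theorem driveBits_transmit {hist c : List Bool} (hδ : IsTransmitDriver δ hist c) :
    driveBits δ hist c.length = c := by
  have key : ∀ j ≤ c.length, driveBits δ hist j = c.take j := by
    intro j
    induction j with
    | zero => intro _; rfl
    | succ j ih =>
      intro hj
      rw [driveBits_succ, ih (Nat.le_of_succ_le hj), hδ _ (by rw [List.length_take]; omega),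
        List.length_take, min_eq_left (Nat.le_of_succ_le hj), PRelSigma.take_succ_eq_getD c (by omega)]
  rw [key _ le_rfl, List.take_length]

/-- **A block made of a search part and a transmission part.** If on the first `s` rounds the
driver prefix-searches `R` and on the next `|c w|` rounds it transmits a string `c w` computed from
the witness `w` it has just found, then the block is `w ++ c w` with `R w`.
[cite: FournierKoiran2000, §2.1 (find `h` by prefix search, then test it)] -/
theorem driveBits_search_then_transmit {hist : List Bool} {R : List Bool → Prop} {s t : ℕ}
    {c : List Bool → List Bool} (hc : ∀ w, (c w).length = t)
    (hsearch : IsPrefixSearchDriver δ hist R s) (hex : ∃ w : List Bool, w.length = s ∧ R w)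
    (htrans : ∀ w : List Bool, w.length = s → R w → IsTransmitDriver δ (hist ++ w) (c w)) :
    ∃ w : List Bool, w.length = s ∧ R w ∧ driveBits δ hist (s + t) = w ++ c w := by
  refine ⟨driveBits δ hist s, length_driveBits hist s, driveBits_prefixSearch hsearch hex, ?_⟩
  rw [driveBits_add, ← hc (driveBits δ hist s),
    driveBits_transmit (htrans _ (length_driveBits hist s) (driveBits_prefixSearch hsearch hex))]

end FKTransfer

end Literature.Computability.Complexity
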